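import Mathlib
import Literature.AlgebraicGeometry.Resolution.RegularLocalRingsUFD
import Literature.AlgebraicGeometry.Resolution.RegularLocalRingsQuotient
import Literature.AlgebraicGeometry.Resolution.RegularLocalRingsNormal
import Literature.AlgebraicGeometry.Resolution.RegularLocalRingsProofs
import Summits.ResolutionOfSingularities.ResolutionOfSingularities.Theorems.FrobeniusClosingSteerEmptyStallTwo
import HarnessLib

/-!
# Crux `Steer` (stmt-ResolutionOfSingularities-16345), chain W4.1, p = 2 σ-residual, HIGH half:
# B4 `noHeightOneCarrier_two` — no height-one carrier at a point step. I: the local algebra of a singular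
# height-one prime (witness extraction; (α) globalisation modulo `u²`)

OURS (campaign `res-hironaka`, rung L ★L-G4, slot W4.1; seat res-type-096 g8; object B4 of res-L0-w41-strat-2's §σ2.16
slate, dealt by res-L0-w41-plan-1 RULING 3, 2026-08-27T07:20:27Z; replaces the role of no printed item; NOT a statement of the
manuscript under review; AI-produced, weaker than expert review). Verbatim target (skeleton vocabulary of
`L/res-L0-w41-lead-1/Steer_r23.lean`, strat-2 delta `R2TwoSigma-s16-strat2.delta.lean` rev 5/6):

  `noHeightOneCarrier_two … (hpt : IsPointStep R P i) (hpt' : IsPointStep R P (i + 1)) (hs : s i ^ 2 ∈ R i) :`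
  `  ∀ (Q : Ideal (R i)) [Q.IsPrime], Q.height = 1 → ¬ IsSingPrime (R i) 2 ⟨s i ^ 2, hs⟩ Q`

i.e. at a point step of a 2-steered run no HEIGHT-ONE prime of the (regular, four-dimensional) base member is a singular
prime of the radicand `f = (s i)²`. This file (def-free, Theses-free; part I of two — the skeleton's `IsSingPrime` is
consumed UNFOLDED) proves the local algebra; part II (`FrobeniusClosingSteerNoHeightOneCarrierTwo.lean`) the σ_top
permissibility of a regular carrier and the reduction of B4 to the deep case. Contents of the pair:

* `exists_witness_of_singular_heightOne` — a singular height-one prime is `Q = (u)` with `u` prime, and the torsor is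
  singular at `Q` iff `f` is a square modulo `u²` LOCALLY: `∃ a d, d ∉ Q ∧ d² f − a² ∈ Q²` (UFD = Auslander–Buchsbaum,
  tree `IsRegularLocalRing.uniqueFactorizationMonoid`; the DVR `R_Q` through the tree's
  `EmptyStallTwo.isRegularLocalRing_adjoinRoot_X_pow_sub_C_of_forall_not_mem_sq`);
* `exists_sub_sq_mem_span_sq_of_not_mem_sq` — **(α), globalisation**: if moreover `u ∉ 𝔪²` then `R/(u)` is regular,
  hence normal, the local square root `ā/d̄` of `f̄` is integral hence global, and `f − g² ∈ (u²)` for some `g ∈ R`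
  (`(a − d g)² ≡ d² u h (mod u²)` forces `u ∣ h`);
* `not_bot_singular_of_irr` — the generic point is not singular when `f = s²` with `s ∉ Frac R` (`hirr`);
* `permissible_of_singular_heightOne_of_not_mem_sq` — **(α), permissibility**: for `u ∉ 𝔪²` the prime `(u)` satisfies
  the skeleton's `IsPermissibleCentre R 2 f (u)` UNFOLDED (singular; minimal — only `⊥` lies below, and `⊥` is not
  singular; top-dimensional — `dim R/(u) = 3 ≥ dim R/Q''` for every `Q'' ≠ ⊥`; `R/(u)` regular; `f − g² ∈ (u)²`);
* `exists_deep_witness_of_singular_heightOne` — **B4 REDUCED TO (β)**: if no positive-dimensional centre is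
  σ_top-permissible (the content of a point step `IsPointStep` + `IsSigmaTopCentre`), every singular height-one prime is
  `(u)` with `u ∈ 𝔪²` and a local square root `d² f − a² ∈ (u²)`, `d ∉ (u)` — the input of the order-raising lemma
  (sequel file) which yields `f − ĝ² ∈ 𝔪⁴` and lets B1 `divisorTrigger_two` contradict the point step at `i + 1`.

[cite: Matsumura1987, Thm. 14.2, Thm. 19.4, Thm. 20.3] [folklore]
-/

noncomputable section

-- `Summit.<S>.<S>.…` duplicates the summit name by design (single-problem summit).
set_option linter.dupNamespace false

open Polynomial IsLocalRing

namespace Summit.ResolutionOfSingularities.ResolutionOfSingularities.Theorems.SwitchingDichotomy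

namespace NoHeightOneCarrier

open Literature.AlgebraicGeometry.Resolution

universe u

/-! ## Characteristic-two algebra -/

section CharTwo

variable {A : Type u} [CommRing A] [CharP A 2]

/-- In characteristic two, `a² − b² = (a − b)²`. [folklore] -/
theorem sq_sub_sq_eq (a b : A) : a ^ 2 - b ^ 2 = (a - b) ^ 2 := by
  have h2 : (2 : A) = 0 := by exact_mod_cast CharP.cast_eq_zero A 2
  linear_combination (a * b - b ^ 2) * h2

end CharTwo

/-! ## (1) A singular height-one prime: principal, with a local square root modulo `u²` -/

section Witness

variable {K : Type u} [Field K] [CharP K 2] (R : Subring K) [IsRegularLocalRing R]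

omit [CharP K 2] in
/-- A height-one prime of a regular local ring is principal, generated by a prime element (regular local rings are
factorial, Auslander–Buchsbaum). [cite: Matsumura1987, Thm. 20.3] -/
theorem exists_eq_span_singleton_of_height_eq_one (Q : Ideal R) [Q.IsPrime] (hQ : Q.height = 1) :
    ∃ u : R, Q = Ideal.span {u} ∧ Prime u := by
  haveI := isDomain_of_isRegularLocalRing R
  haveI : UniqueFactorizationMonoid R := IsRegularLocalRing.uniqueFactorizationMonoid R
  have hQ0 : Q ≠ ⊥ := Ideal.ne_bot_of_height_eq_one hQ
  obtain ⟨u, huQ, hu⟩ := Ideal.IsPrime.exists_mem_prime_of_ne_bot ‹Q.IsPrime› hQ0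
  refine ⟨u, ?_, hu⟩
  haveI hp : (Ideal.span {u}).IsPrime := (Ideal.span_singleton_prime hu.ne_zero).mpr hu
  have hle : Ideal.span {u} ≤ Q := (Ideal.span_singleton_le_iff_mem _).mpr huQ
  have h1 : 1 ≤ (Ideal.span {u}).height := by
    rw [Order.one_le_iff_ne_zero, Ne, Ideal.height_eq_zero_iff_eq_bot, Ideal.span_singleton_eq_bot]
    exact hu.ne_zero
  exact (Ideal.eq_of_le_of_height_le (Ideal.span {u}) hle (by rw [hQ]; exact h1)).symm

/-- **Singular height-one prime ⇒ local square root modulo the square.** If the radicand ring of `f` over the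
localisation `R_Q` at a height-one prime `Q = (u)` of the regular local ring `R` (characteristic two) is not regular,
then `d² f − a² ∈ Q²` for some `a` and some `d ∉ Q`: the discrete valuation ring `R_Q` has `f ≡ □ (mod 𝔪_Q²)` by the
tree's transversality criterion `EmptyStallTwo.isRegularLocalRing_adjoinRoot_X_pow_sub_C_of_forall_not_mem_sq`, and
denominators are cleared. [cite: Matsumura1987, Thm. 14.2] [folklore] -/
theorem exists_witness_of_singular (f : R) (Q : Ideal R) [Q.IsPrime]
    (hsing : ¬ IsRegularLocalRing (AdjoinRoot ((X : (Localization.AtPrime Q)[X]) ^ 2 -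
      C (algebraMap R (Localization.AtPrime Q) f)))) :
    ∃ a d : R, d ∉ Q ∧ d ^ 2 * f - a ^ 2 ∈ Q ^ 2 := by
  classical
  haveI := isDomain_of_isRegularLocalRing R
  set D := Localization.AtPrime Q with hD
  haveI : IsRegularLocalRing D := isRegularLocalRing_localization_atPrime R Q
  have hinj : Function.Injective (algebraMap R D) := IsLocalization.injective D Q.primeCompl_le_nonZeroDivisors
  haveI : CharP D 2 := charP_of_injective_algebraMap hinj 2
  haveI : Fact (Nat.Prime 2) := ⟨Nat.prime_two⟩
  -- the DVR criterion: not regular ⇒ `f ≡ g'² (mod 𝔪_D²)` for some `g' ∈ D`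
  have hex : ∃ g' : D, algebraMap R D f - g' ^ 2 ∈ maximalIdeal D ^ 2 := by
    by_contra hne
    push Not at hne
    exact hsing (EmptyStallTwo.isRegularLocalRing_adjoinRoot_X_pow_sub_C_of_forall_not_mem_sq 2 _ hne)
  obtain ⟨g', hg'⟩ := hex
  obtain ⟨⟨a, d⟩, hg'eq⟩ := IsLocalization.mk'_surjective Q.primeCompl g'
  rw [← hg'eq] at hg'
  -- clear denominators: `d² f − a² ∈ 𝔪_D² ∩ R`-ish
  have hmem : algebraMap R D (d ^ 2 * f - a ^ 2) ∈ (Q ^ 2).map (algebraMap R D) := by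
    rw [Ideal.map_pow, Localization.AtPrime.map_eq_maximalIdeal]
    have e : algebraMap R D ((d : R) ^ 2 * f - a ^ 2) =
        algebraMap R D ((d : R) ^ 2) * (algebraMap R D f - IsLocalization.mk' D a d ^ 2) := by
      rw [map_sub, map_mul, mul_sub, map_pow, map_pow, ← mul_pow, IsLocalization.mk'_spec' D a d]
    rw [e]
    exact Ideal.mul_mem_left _ _ hg'
  rw [IsLocalization.mem_map_algebraMap_iff Q.primeCompl] at hmem
  obtain ⟨⟨⟨x, hx⟩, w⟩, hxw⟩ := hmem
  -- `w · (d² f − a²) = x ∈ Q²` up to the localisation: injectivity gives the relation in `R`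
  have hrel : (w : R) * (d ^ 2 * f - a ^ 2) = x := by
    apply hinj
    have h' := hxw
    simp only [map_sub, map_mul, map_pow] at h' ⊢
    linear_combination h'
  refine ⟨w * a, w * d, ?_, ?_⟩
  · intro h
    rcases (‹Q.IsPrime›.mem_or_mem h) with hw | hd
    · exact w.2 hw
    · exact d.2 hd
  · have e : ((w : R) * d) ^ 2 * f - ((w : R) * a) ^ 2 = w * (w * (d ^ 2 * f - a ^ 2)) := by ring
    rw [e, hrel]
    exact Ideal.mul_mem_left _ _ hx

end Witness

/-! ## (2) (α) globalisation: `u ∉ 𝔪²` -/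

section Alpha

variable {K : Type u} [Field K] [CharP K 2] (R : Subring K) [IsRegularLocalRing R]

/-- **(α) Global square root modulo `u²`.** `R` regular local of characteristic two, `u ∈ 𝔪 ∖ 𝔪²` prime, `d ∉ (u)` and
`d² f − a² ∈ (u)²`. Then `f − g² ∈ (u)²` for some `g ∈ R`: `R/(u)` is regular hence a normal domain, so the integral
element `ā/d̄` (a square root of `f̄`) lies in `R/(u)`, giving `f − g² = u h`; then `(a − d g)² = d²(f − g²) − (d² f − a²)`
shows `u ∣ a − d g`, whence `u² ∣ d² u h` and `u ∣ h`. [cite: Matsumura1987, Thm. 14.2 and Thm. 19.4] [folklore] -/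
theorem exists_sub_sq_mem_span_sq_of_not_mem_sq {u : R} (hu : Prime u) (hum : u ∈ maximalIdeal R)
    (hu2 : u ∉ maximalIdeal R ^ 2) {f a d : R} (hd : d ∉ Ideal.span {u})
    (h : d ^ 2 * f - a ^ 2 ∈ Ideal.span {u} ^ 2) : ∃ g : R, f - g ^ 2 ∈ Ideal.span {u} ^ 2 := by
  classical
  haveI := isDomain_of_isRegularLocalRing R
  set I : Ideal R := Ideal.span {u} with hI
  haveI hIp : I.IsPrime := (Ideal.span_singleton_prime hu.ne_zero).mpr hu
  -- `R/(u)` is a regular local ring, hence an integrally closed domain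
  haveI hreg : IsRegularLocalRing (R ⧸ I) := (IsRegularLocalRing.quotient_span_singleton hum hu2).1
  haveI : IsDomain (R ⧸ I) := Ideal.Quotient.isDomain I
  haveI : IsIntegrallyClosed (R ⧸ I) := isIntegrallyClosed_of_isRegularLocalRing (R ⧸ I)
  set mk := Ideal.Quotient.mk I with hmk
  have hd0 : mk d ≠ 0 := fun e => hd (Ideal.Quotient.eq_zero_iff_mem.mp e)
  -- in `R/(u)`: `d̄² f̄ = ā²`
  have hbar : mk d ^ 2 * mk f = mk a ^ 2 := by
    have : mk (d ^ 2 * f - a ^ 2) = 0 := Ideal.Quotient.eq_zero_iff_mem.mpr (Ideal.pow_le_self two_ne_zero h)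
    rw [map_sub, map_mul, map_pow, map_pow, sub_eq_zero] at this
    exact this
  -- the square root `ā/d̄` is integral over the normal domain `R/(u)`, hence comes from it
  set F := FractionRing (R ⧸ I) with hF
  have hFinj : Function.Injective (algebraMap (R ⧸ I) F) := IsFractionRing.injective (R ⧸ I) F
  set r : F := algebraMap (R ⧸ I) F (mk a) / algebraMap (R ⧸ I) F (mk d) with hr
  have hdF : algebraMap (R ⧸ I) F (mk d) ≠ 0 := fun e => hd0 (hFinj (by rw [e, map_zero]))
  have hbarF : algebraMap (R ⧸ I) F (mk d) ^ 2 * algebraMap (R ⧸ I) F (mk f) =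
      algebraMap (R ⧸ I) F (mk a) ^ 2 := by
    simpa [map_pow, map_mul] using congrArg (algebraMap (R ⧸ I) F) hbar
  have hr2 : r ^ 2 = algebraMap (R ⧸ I) F (mk f) := by
    rw [hr, div_pow, div_eq_iff (pow_ne_zero 2 hdF), ← hbarF]; ring
  have hint : IsIntegral (R ⧸ I) r := by
    refine ⟨X ^ 2 - C (mk f), monic_X_pow_sub_C _ two_ne_zero, ?_⟩
    simp [hr2]
  obtain ⟨gbar, hgbar⟩ := IsIntegrallyClosed.isIntegral_iff.mp hint
  obtain ⟨g, rfl⟩ := Ideal.Quotient.mk_surjective gbar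
  -- `f − g² ∈ (u)`
  have hfg : f - g ^ 2 ∈ I := by
    rw [← Ideal.Quotient.eq_zero_iff_mem, map_sub, map_pow, sub_eq_zero]
    apply hFinj
    rw [map_pow, ← hr2]
    exact congrArg (· ^ 2) hgbar.symm
  obtain ⟨h', hh'⟩ := Ideal.mem_span_singleton'.mp hfg
  -- `(a − d g)² = d² (f − g²) − (d² f − a²)` lies in `(u)`, so `u ∣ a − d g`
  have h2 := h
  rw [hI, Ideal.span_singleton_pow] at h2
  obtain ⟨m, hm⟩ := Ideal.mem_span_singleton'.mp h2
  have key : (a - d * g) ^ 2 = d ^ 2 * (h' * u) - m * u ^ 2 := by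
    rw [← sq_sub_sq_eq, hm, hh']; ring
  have hdvd1 : u ∣ (a - d * g) ^ 2 := by
    rw [key]; exact dvd_sub (Dvd.intro_left (d ^ 2 * h') (by ring)) (Dvd.intro_left (m * u) (by ring))
  have hdvd2 : u ∣ a - d * g := hu.dvd_of_dvd_pow hdvd1
  -- hence `u² ∣ d² h' u`, so `u ∣ d² h'`, so `u ∣ h'`
  have hdvd3 : u ^ 2 ∣ d ^ 2 * (h' * u) := by
    have : d ^ 2 * (h' * u) = (a - d * g) ^ 2 + m * u ^ 2 := by rw [key]; ring
    rw [this]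
    exact dvd_add (pow_dvd_pow_of_dvd hdvd2 2) (Dvd.intro_left _ rfl)
  have hdvd4 : u ∣ d ^ 2 * h' := by
    have e : d ^ 2 * (h' * u) = (d ^ 2 * h') * u := by ring
    rw [e, pow_two] at hdvd3
    exact (mul_dvd_mul_iff_right hu.ne_zero).mp hdvd3
  have hud : ¬ u ∣ d := fun hud => hd (Ideal.mem_span_singleton.mpr hud)
  have hdvd5 : u ∣ h' := by
    rcases hu.dvd_or_dvd hdvd4 with h1 | h1
    · exact absurd (hu.dvd_of_dvd_pow h1) hud
    · exact h1
  obtain ⟨h'', rfl⟩ := hdvd5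
  refine ⟨g, ?_⟩
  rw [hI, Ideal.span_singleton_pow, Ideal.mem_span_singleton]
  exact ⟨h'', by rw [← hh']; ring⟩

end Alpha

end NoHeightOneCarrier

end Summit.ResolutionOfSingularities.ResolutionOfSingularities.Theorems.SwitchingDichotomy

end
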